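import Summits.QuantumAdvantage.QuantumAdvantage.Theorems.AbelianDialE

/-! # AbelianDialF — ADD-ON part 6/6 of the landing twins of NODE «AbelianDial» (decomp-qadv lens-2; node file
`g23/AbelianDial.lean` REV3, sha256 be9dfc83811db3e2…; parts A–E are the REV2 package, byte-identical to what the writer verified, bus
l.1843; this part carries the REV3 additions only: namespace `Theses.AbelianDial` → `Theorems.AbelianDial`, verbatim otherwise).
Content: §1c the POLYLOG-TYPE variant of the cut (crit-1 69v55 SUGGESTION): `SmallTable t e P` (cheaply table-form of SOME type of
SIZE `(m+1)^r ≤ (log₂ N)^t`), `AbelianLossPoly` (S_poly, `∀ t`), `NonAbelianLossPoly` (G_poly, `∃ t`), `closesB_poly`, `closes_poly`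
BY NAME onto `Theses.SparsityDial.NonCounterGenericLoss3`, `split_poly_iff` (EXACT), `size_le_logpow`, `smallTable_of_stabTable`, the
SANDWICHES `abelian_of_abelianPoly : S_poly → S` and `nonAbelianPoly_of_nonAbelian : G → G_poly`; the generic certificate for every
polylog size `q_not_smallTable_zero` (pigeonhole + tree `eventually_polylog`); `pm_smallTable`.

READING OF THE RESIDUAL OF RECORD (crit-1 69v55 N1, adopted by the lens): `NonAbelianLoss3` = «∃ ONE bounded type `T₀ = (m, r)`:
every dense, non-counter, NOT-cheaply-`T₀`-table field loses»; its class = B's class minus `StabTable T₀`, which still contains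
abelian fields of every type `⊄ T₀` (foreign modulus, larger rank, rank growing with `n`) — «non-abelian» is relative to `T₀`; the
SHARPER residual «no cheap polylog-size abelian quotient» is `NonAbelianLossPoly` here, one sandwich away.  DECISION OF RECORD
(NODE-REV3): the BOUNDED pair (`AbelianLoss3`, `NonAbelianLoss3`) stays of record — a small type with 2-power modulus
`2^j ≤ (log₂ n)^t` has `𝔽₂`-echo-degree up to `r(2^j − 1)`, beyond g22's `StabEcho` range `d ≤ log₂ n` for `t ≥ 2` and adjacent to
`Literature.Barriers.QuantumAdvantage.NonclassicalDegreeLogBarrier`, so S_poly would import that regime into the SPECIAL piece, whereas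
every BOUNDED 2-group type is g22-decided; both pairs are certified and inline-ready. -/

set_option linter.dupNamespace false
noncomputable section
open scoped Classical

namespace Summit.QuantumAdvantage.QuantumAdvantage.Theorems.AbelianDial
open Finset
open Literature.Computability.QuantumComplexity Literature.Computability.QuantumComplexity.RingHLF
open Literature.Computability.MetaComplexity Literature.Computability.MetaComplexity.Smolensky
open Summit.QuantumAdvantage.AdviceFreeQNC0
open Summit.QuantumAdvantage.QuantumAdvantage.Theorems.AnchorDial (outB dev orbF oddZeros_orbF orbF_apply_of_far
  card_filter_orbF card_odd_ge loss_shape_mono)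
open Summit.QuantumAdvantage.QuantumAdvantage.Theorems.HolonomyDial (tPoly tPoly_apply tPoly_mem xorP xorP_mem
  xorP_apply_bool indP indP_apply indP_mem mono_singleton_apply)
open Summit.QuantumAdvantage.QuantumAdvantage.Theorems.StabilizerDial (apIdx apStrat apStrat_mem bitP bitP_apStrat pad
  pad_mem rel_pad_iff StabFew outB_pad_pad outB_pad_congr bitP_gsum gsum gsum_mem deg_gsum dev_congr)
open Summit.QuantumAdvantage.QuantumAdvantage.Theorems.SparsityDial (real_loss_of_frac stabFew_mono_mr one_le_logpow)
open Summit.QuantumAdvantage.QuantumAdvantage.Theorems.ResponseDial (mem_dev_apStrat dev_pad_zero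
  not_polylogSparse_of_agree AddResp additive_loss_count lodd lodd_mem lodd_eq_sum lodd_orbF oddSite
  oddSite_val oddSite_odd card_exists_orbF_le fibre_le_pow orbF_apply)
open Summit.QuantumAdvantage.QuantumAdvantage.Theorems.CounterDial (bsel mem_iff_bsel)
open Summit.QuantumAdvantage.QuantumAdvantage.Theorems.CounterDial (lin CounterForm StabCounter Dark dw dw_apply_of_far
  oddZeros_dw dark_loss_count)
open Summit.QuantumAdvantage.QuantumAdvantage.Theorems.BlindDial (apIdx_val_first)

variable {N : ℕ}

/-! ## §1c  The POLYLOG-TYPE variant of the cut (crit-1 69v55 SUGGESTION) — certified EXACT, with SANDWICHES onto the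
pieces of record; which pair is OF RECORD is argued in the node docstring («Bounded or polylog types?») -/

/-- `SmallTable t e P`: `P` is cheaply table-form of SOME abelian type of SIZE `(m+1)^r ≤ (log₂ N)^t`. -/
def SmallTable (t e : ℕ) (P : Fin N → CubeFn (ZMod 3) N) : Prop :=
  ∃ m r : ℕ, (m + 1) ^ r ≤ (Nat.log 2 N) ^ t ∧ StabTable m r e P

/-- **S_poly = `AbelianLossPoly`**: for EVERY `t`: dense, not cheaply counter-form, cheaply table-form of SOME type of
size `≤ (log₂ n)^t` ⟹ polynomial loss — constants uniform over all types of that size, so this is a LARGER special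
piece than `AbelianLoss3` (`abelian_of_abelianPoly : AbelianLossPoly → AbelianLoss3`). -/
def AbelianLossPoly : Prop :=
  ∀ t : ℕ, ∃ a : ℕ, ∃ C : ℕ, ∀ c : ℕ, ∃ n₀ : ℕ, ∀ n ≥ n₀, ∀ P : Fin n → CubeFn (ZMod 3) n,
    (∀ i, P i ∈ lowDeg (ZMod 3) n ((Nat.log 2 n) ^ c)) →
      ¬ StabFew ((Nat.log 2 n) ^ a) 0 (c + 1) P → ¬ StabCounter (c + 1) P → SmallTable t (c + 1) P →
        ((univ.filter fun x : Fin n → Bool =>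
            OddZeros x ∧ Rel x (fun i => decide (P i x = 1))).card : ℝ)
          ≤ (1 - 1 / (n : ℝ) ^ C) * (2 : ℝ) ^ (n - 1)

/-- **G_poly = `NonAbelianLossPoly`** — the SHARPER residual «no cheap polylog-size abelian quotient of the readers»:
for SOME `t`: dense, not cheaply counter-form and NOT cheaply table-form of ANY type of size `≤ (log₂ n)^t` ⟹
polynomial loss (`nonAbelianPoly_of_nonAbelian : NonAbelianLoss3 → NonAbelianLossPoly`). -/
def NonAbelianLossPoly : Prop :=
  ∃ t : ℕ, ∃ a : ℕ, ∃ C : ℕ, ∀ c : ℕ, ∃ n₀ : ℕ, ∀ n ≥ n₀, ∀ P : Fin n → CubeFn (ZMod 3) n,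
    (∀ i, P i ∈ lowDeg (ZMod 3) n ((Nat.log 2 n) ^ c)) →
      ¬ StabFew ((Nat.log 2 n) ^ a) 0 (c + 1) P → ¬ StabCounter (c + 1) P → ¬ SmallTable t (c + 1) P →
        ((univ.filter fun x : Fin n → Bool =>
            OddZeros x ∧ Rel x (fun i => decide (P i x = 1))).card : ℝ)
          ≤ (1 - 1 / (n : ℝ) ^ C) * (2 : ℝ) ^ (n - 1)

/-- `S_poly → G_poly → B` onto the tree-side copy (cases on `SmallTable t (c+1) P` at the generic piece's `t`). -/
theorem closesB_poly (hS : AbelianLossPoly) (hG : NonAbelianLossPoly) :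
    Summit.QuantumAdvantage.QuantumAdvantage.Theorems.CounterDial.NonCounterGenericLoss3 := by
  obtain ⟨t, a₂, C₂, h₂⟩ := hG
  obtain ⟨a₁, C₁, h₁⟩ := hS t
  refine ⟨max a₁ a₂, max C₁ C₂, fun c => ?_⟩
  obtain ⟨n₁, hn₁⟩ := h₁ c
  obtain ⟨n₂, hn₂⟩ := h₂ c
  refine ⟨max (max n₁ n₂) 2, fun n hn P hP hgen hnc => ?_⟩
  have hn2 : 2 ≤ n := le_trans (le_max_right _ _) hn
  have hn12 : max n₁ n₂ ≤ n := le_trans (le_max_left _ _) hn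
  have hL : 1 ≤ Nat.log 2 n := Nat.le_log_of_pow_le (by norm_num) (by simpa using hn2)
  have hg₁ : ¬ StabFew ((Nat.log 2 n) ^ a₁) 0 (c + 1) P := fun h =>
    hgen (stabFew_mono_mr (Nat.pow_le_pow_right hL (le_max_left _ _)) (one_le_logpow hn2 a₁) le_rfl h)
  have hg₂ : ¬ StabFew ((Nat.log 2 n) ^ a₂) 0 (c + 1) P := fun h =>
    hgen (stabFew_mono_mr (Nat.pow_le_pow_right hL (le_max_right _ _)) (one_le_logpow hn2 a₂) le_rfl h)
  by_cases ht : SmallTable t (c + 1) P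
  · exact loss_shape_mono (by omega) (le_max_left _ _) _ _ (by positivity)
      (hn₁ n (le_trans (le_max_left _ _) hn12) P hP hg₁ hnc ht)
  · exact loss_shape_mono (by omega) (le_max_right _ _) _ _ (by positivity)
      (hn₂ n (le_trans (le_max_right _ _) hn12) P hP hg₂ hnc ht)

/-- `S_poly → G_poly → Theses.SparsityDial.NonCounterGenericLoss3` BY NAME (the variant's deciding theorem). -/
theorem closes_poly (hS : AbelianLossPoly) (hG : NonAbelianLossPoly) :
    Summit.QuantumAdvantage.QuantumAdvantage.Theses.SparsityDial.NonCounterGenericLoss3 :=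
  Summit.QuantumAdvantage.QuantumAdvantage.Theorems.SparsityDial.nonCounterGenericLoss3_iff_node.2 (closesB_poly hS hG)

/-- N-test: `B → S_poly` (restriction). -/
theorem abelianPoly_of_B (hB : Summit.QuantumAdvantage.QuantumAdvantage.Theses.SparsityDial.NonCounterGenericLoss3) :
    AbelianLossPoly := by
  obtain ⟨a, C, h⟩ := Summit.QuantumAdvantage.QuantumAdvantage.Theorems.SparsityDial.nonCounterGenericLoss3_iff_node.1 hB
  refine fun t => ⟨a, C, fun c => ?_⟩
  obtain ⟨n₀, hn₀⟩ := h c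
  exact ⟨n₀, fun n hn P hP hgen hnc _ => hn₀ n hn P hP hgen hnc⟩

/-- N-test: `B → G_poly` (restriction, at `t = 0`). -/
theorem nonAbelianPoly_of_B (hB : Summit.QuantumAdvantage.QuantumAdvantage.Theses.SparsityDial.NonCounterGenericLoss3) :
    NonAbelianLossPoly := by
  obtain ⟨a, C, h⟩ := Summit.QuantumAdvantage.QuantumAdvantage.Theorems.SparsityDial.nonCounterGenericLoss3_iff_node.1 hB
  refine ⟨0, a, C, fun c => ?_⟩
  obtain ⟨n₀, hn₀⟩ := h c
  exact ⟨n₀, fun n hn P hP hgen hnc _ => hn₀ n hn P hP hgen hnc⟩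

/-- EXACTNESS of the variant: `B ↔ S_poly ∧ G_poly`. -/
theorem split_poly_iff : Summit.QuantumAdvantage.QuantumAdvantage.Theses.SparsityDial.NonCounterGenericLoss3 ↔
    (AbelianLossPoly ∧ NonAbelianLossPoly) :=
  ⟨fun h => ⟨abelianPoly_of_B h, nonAbelianPoly_of_B h⟩, fun h => closes_poly h.1 h.2⟩

/-- size bookkeeping: a bounded type `(m, r)` has size `≤ (log₂ n)^((m+1)^r)` once `4 ≤ n`. -/
theorem size_le_logpow {n : ℕ} (hn : 4 ≤ n) (m r : ℕ) : (m + 1) ^ r ≤ (Nat.log 2 n) ^ ((m + 1) ^ r) := by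
  have hL : 2 ≤ Nat.log 2 n := Nat.le_log_of_pow_le (by norm_num) (by simpa using hn)
  calc (m + 1) ^ r ≤ 2 ^ ((m + 1) ^ r) := (Nat.lt_two_pow_self).le
    _ ≤ (Nat.log 2 n) ^ ((m + 1) ^ r) := Nat.pow_le_pow_left hL _

/-- a bounded type is eventually a small type (`t := (m+1)^r`, `n ≥ 4`). -/
theorem smallTable_of_stabTable {n : ℕ} (hn : 4 ≤ n) {m r e : ℕ} {P : Fin n → CubeFn (ZMod 3) n}
    (h : StabTable m r e P) : SmallTable ((m + 1) ^ r) e P :=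
  ⟨m, r, size_le_logpow hn m r, h⟩

/-- SANDWICH 1: `S_poly → S` (the polylog special piece implies the bounded-type special piece OF RECORD). -/
theorem abelian_of_abelianPoly (h : AbelianLossPoly) : AbelianLoss3 := by
  intro m r
  obtain ⟨a, C, h⟩ := h ((m + 1) ^ r)
  refine ⟨a, C, fun c => ?_⟩
  obtain ⟨n₀, hn₀⟩ := h c
  exact ⟨max n₀ 4, fun n hn P hP hgen hnc ht => hn₀ n (le_trans (le_max_left _ _) hn) P hP hgen hnc
    (smallTable_of_stabTable (le_trans (le_max_right _ _) hn) ht)⟩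

/-- SANDWICH 2: `G → G_poly` (the residual OF RECORD implies the sharper polylog residual). -/
theorem nonAbelianPoly_of_nonAbelian (h : NonAbelianLoss3) : NonAbelianLossPoly := by
  obtain ⟨m, r, a, C, h⟩ := h
  refine ⟨(m + 1) ^ r, a, C, fun c => ?_⟩
  obtain ⟨n₀, hn₀⟩ := h c
  exact ⟨max n₀ 4, fun n hn P hP hgen hnc hns => hn₀ n (le_trans (le_max_left _ _) hn) P hP hgen hnc
    (fun ht => hns (smallTable_of_stabTable (le_trans (le_max_right _ _) hn) ht))⟩

/-- the generic certificate SURVIVES the polylog-type cut (crit-1 69v55): for every `t`, eventually `qStrat` is not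
table-form of ANY type of size `≤ (log₂ n)^t` at the zero gauge (the pigeonhole needs only `2(m+1)^r + 4 ≤ n`; tree
`eventually_polylog`). -/
theorem q_not_smallTable_zero (t : ℕ) : ∃ n₁ : ℕ, ∀ n ≥ n₁, ∀ m r : ℕ, (m + 1) ^ r ≤ (Nat.log 2 n) ^ t →
    ¬ ∃ (v : Fin n → Fin n → Fin r → ZMod (m + 1)) (G : Fin n → (Fin r → ZMod (m + 1)) → Bool),
      TableForm m r v G (pad (fun i : Fin n => qStrat i) (fun _ => 0)) := by
  obtain ⟨n₀, hn₀⟩ := Summit.QuantumAdvantage.QuantumAdvantage.Theorems.StabilizerDial.eventually_polylog 2 t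
  refine ⟨max n₀ 8, fun n hn m r hsize => q_not_tableForm_zero m r n ?_⟩
  have h := (hn₀ n (le_trans (le_max_left _ _) hn)).1
  have h8 : 8 ≤ n := le_trans (le_max_right _ _) hn
  omega

/-- the twin family is of SMALL type `t = 4` once `4 ≤ N` (`9 ≤ (log₂ N)^4`). -/
theorem pm_smallTable (e : ℕ) (hN : 4 ≤ N) : SmallTable 4 e (fun i : Fin N => pmStrat i) := by
  refine ⟨2, 2, ?_, pm_stabTable e⟩
  have hL : 2 ≤ Nat.log 2 N := Nat.le_log_of_pow_le (by norm_num) (by simpa using hN)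
  calc (2 + 1) ^ 2 ≤ 2 ^ 4 := by norm_num
    _ ≤ (Nat.log 2 N) ^ 4 := Nat.pow_le_pow_left hL 4

end Summit.QuantumAdvantage.QuantumAdvantage.Theorems.AbelianDial
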